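import Mathlib
import Summits.ResolutionOfSingularities.ResolutionOfSingularities.Theorems.RadicialJungCleanModelsCleanLU3CompositeAssembly
import Summits.ResolutionOfSingularities.ResolutionOfSingularities.Theorems.RadicialJungCleanModelsCleanLU3CompositeDownstairsCases
import Summits.ResolutionOfSingularities.ResolutionOfSingularities.Theorems.RadicialJungCleanModelsCleanLU3CompositePersistCases
import Summits.ResolutionOfSingularities.ResolutionOfSingularities.Theorems.RadicialJungCleanModelsCleanLU3CompositePersistFirstOrder
import Summits.ResolutionOfSingularities.ResolutionOfSingularities.Theorems.RadicialJungCleanModelsCleanLU2OfRegularAffine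
import Summits.ResolutionOfSingularities.ResolutionOfSingularities.Theorems.RadicialJungCleanModelsCleanLU2RegularAffineModel
import Literature.AlgebraicGeometry.Resolution.ArithmeticalThreefoldsLocalRankReduction
import HarnessLib

/-!
# Route `RadicialJung`, crux `CleanModels` (stmt-15917), stub `stub_cleanLU3DefectNonDiscrete` (:219): **the (C-div) SLICE, KERNEL-CLOSED**
# — clean local uniformization at composite zero-dimensional valuations with a DIVISORIAL coarsening, dimension 3, every ground field

Lead `res-B-lead-1` (g3–g5), with seats `res-B-cdiv-w1…w5` and critic `res-B-crit-1`.  OURS; nothing here proves resolution in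
characteristic `p`.  The two theorems below are the targets of the crux workfile `Cruxes/CleanModels/Lines/Sketch_Cdiv_assembly.lean`
(v1–v5), now with ALL FOUR stubs proved — ✓ `stub_persistCases` (`…CompositePersistCases`), ✓ `stub_persistE1`/`stub_persistE2`
(`…CompositePersistFirstOrder`) and `stub_cleanLU2` (D2, THIS FILE: ✓ `exists_regularAffineModel_of_regularAtCentre` by res-B-cdiv-w3 +
✓ `cleanLU2_of_regularAffineModel` by the lead):
* `cleanLU3Defect_of_heightOneCoarsening` — modulo `hEmb` (embedded resolution of surfaces, CJS 2020 Cor. 1.5 ⟸ F-32) only;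
* `cleanLU3Defect_of_divisorialCoarsening` — modulo `hEmb` and F-78 `CossartJannsenSaito2020General` (resolution of excellent surfaces, used
  through ✓ `exists_model_regular_of_lt_of_cjs`, Cossart–Piltant 2019 Prop. 4.10, to reach a model on which the divisorial centre has height one).
Mathematics (memos `Lines/Sketch-memo-nondiscrete-classC.md`, `Sketch-memo-Cdiv-lift.md`): D-abs is `v₁`-continuous ⟹ best `v₁`-approximation;
ramified contradicts `hdefect` ⟹ inert; descend to the residue surface `κ(O₁)` where clean LU holds unconditionally in dimension two (D2, Giraud /
F-75c); track a loosely clean representative with controlled denominators through the quadratic sequence of the residue surface along `Ō`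
(PERSIST, decoupled r.s.p.'s; E1/E2 first-order `p`-th-power facts; MONO); lift along the slice of point blow-ups of the threefold (LIFT LEMMA).
-/

noncomputable section

set_option linter.dupNamespace false -- mandated namespace of this single-conjunct summit

open IsLocalRing AlgebraicGeometry CategoryTheory
open Literature.AlgebraicGeometry.Resolution

namespace Summit.ResolutionOfSingularities.ResolutionOfSingularities.Theorems.RadicialJung.CleanModels

/-- **STUB D2 `stub_cleanLU2`** (workfile `Lines/Sketch_Cdiv_assembly.lean` :80, registered shape): **clean local uniformization in
dimension two, unconditional** (F-75c = ✓ `stub_stacks0BICLocus`): for `p` prime, `k` any field of characteristic `p`, `κ/k` a field, `Ō`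
a valuation ring of `κ`, `Ā ⊆ Ō` a finitely generated `k`-subalgebra with `Frac Ā = κ` whose local ring at the centre of `Ō` is regular of
dimension `2`, every centre of `Ō` above `Ā` closed, and `ū ∉ κ^p`, some finitely generated `Ā' ⊇ Ā` inside `Ō` is regular at the centre of
`Ō` and carries there a loosely clean non-trivial representative of the `κ^p`-line of `ū`.  Proof: ✓ `exists_regularAffineModel_of_regularAtCentre`
then ✓ `cleanLU2_of_regularAffineModel`. [cite: Giraud1983, Thm. 2.4] [cite: StacksProject, Tag 0BIC] -/
theorem stub_cleanLU2 :
    ∀ (p : ℕ), p.Prime →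
    ∀ (k : Type) [Field k] [CharP k p] (κ : Type) [Field κ] [Algebra k κ]
    (Ō : ValuationSubring κ) (Ā : Subalgebra k κ), Ā.toSubring ≤ Ō.toSubring → Ā.FG → IsFractionRing Ā κ →
    IsRegularLocalRing (locAtCentre Ā.toSubring Ō) →
    ringKrullDim (locAtCentre Ā.toSubring Ō) = 2 →
    (∀ (T : Subring κ) (hT : T ≤ Ō.toSubring), Ā.toSubring ≤ T → (subringCentre T Ō hT).IsMaximal) →
    ∀ ū : κ, (∀ c : κ, c ^ p ≠ ū) →
    ∃ (Ā' : Subalgebra k κ), Ā'.toSubring ≤ Ō.toSubring ∧ Ā ≤ Ā' ∧ Ā'.FG ∧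
    ∃ (_ : IsRegularLocalRing (locAtCentre Ā'.toSubring Ō)) (c : Fin p → κ), (∃ j : Fin p, (j : ℕ) ≠ 0 ∧ c j ≠ 0) ∧
    ((∃ (d m : ℕ) (hmd : m ≤ d) (t : Fin d → ↥(locAtCentre Ā'.toSubring Ō)) (a : Fin m → ℕ) (u : ↥(locAtCentre Ā'.toSubring Ō)), IsUnit u ∧
    Ideal.span (Set.range t) = IsLocalRing.maximalIdeal ↥(locAtCentre Ā'.toSubring Ō) ∧
    ringKrullDim ↥(locAtCentre Ā'.toSubring Ō) = (d : WithBot ℕ∞) ∧ 0 < m ∧ (∀ i, ¬ p ∣ a i) ∧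
    (∑ j : Fin p, c j ^ p * ū ^ (j : ℕ)) = (u : κ) * ∏ i : Fin m, ((t (Fin.castLE hmd i) : ↥(locAtCentre Ā'.toSubring Ō)) : κ) ^ (a i)) ∨
    (∃ u : ↥(locAtCentre Ā'.toSubring Ō), IsUnit u ∧ (∑ j : Fin p, c j ^ p * ū ^ (j : ℕ)) = (u : κ) ∧
    ∀ c' : ↥(locAtCentre Ā'.toSubring Ō), u - c' ^ p ∉ IsLocalRing.maximalIdeal ↥(locAtCentre Ā'.toSubring Ō)) ∨
    (∃ s c' : ↥(locAtCentre Ā'.toSubring Ō), (∑ j : Fin p, c j ^ p * ū ^ (j : ℕ)) = (s : κ) ∧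
    s - c' ^ p ∈ IsLocalRing.maximalIdeal ↥(locAtCentre Ā'.toSubring Ō) ∧
    s - c' ^ p ∉ IsLocalRing.maximalIdeal ↥(locAtCentre Ā'.toSubring Ō) ^ 2)) := by
  intro p hp k _ _ κ _ _ Ō Ā hĀŌ hĀfg hfrac hreg hdim hzd ū hū
  obtain ⟨A₁, hA₁Ō, hle, hA₁fg, hfr₁, hregA₁, hA₁dim⟩ :=
    exists_regularAffineModel_of_regularAtCentre p hp k κ Ō Ā hĀŌ hĀfg hfrac hreg hdim hzd
  haveI := hfr₁
  obtain ⟨Ā', hĀ'O, hA₁Ā', hĀ'fg, hrest⟩ := cleanLU2_of_regularAffineModel p hp Ō A₁ hA₁Ō hA₁fg hregA₁ hA₁dim ū hū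
  exact ⟨Ā', hĀ'O, hle.trans hA₁Ā', hĀ'fg, hrest⟩


/-- **(C-div), HEIGHT-ONE CASE — THEOREM (modulo embedded resolution of surfaces `hEmb`, F-32).**  Clean local uniformization at a zero-dimensional
non-Abhyankar valuation `O` of a threefold function field `K/k` (any field `k` of characteristic `p`) for the `K^p`-line of `g₀` WITHOUT best
`p`-th-power approximation, in the presence of a coarsening `O ≤ O₁ ≠ K` whose centre on the regular model is a height-one prime
(`locAtCentre (locAtCentre A O) O₁ = O₁`).  Composition ✓ `cleanLU3Defect_of_heightOneCoarsening_of_cleanMono` ∘ ✓ `exists_cleanMono_stage_of_cases`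
over the four landed stubs ✓ `stub_cleanLU2` (D2), ✓ `stub_persistCases`, ✓ `stub_persistE1`, ✓ `stub_persistE2`.  **Height-one case** — the statement of
`stub_cleanLU3DefectNonDiscrete` (its used hypotheses) PLUS embedded resolution of surfaces `hEmb` (= ✓ `stub_cjs2020Cor15` from F-32) and a
coarsening `O ≤ O₁`, `O ≠ O₁`, which IS the local ring of the model at its centre (`locAtCentre (locAtCentre A O) O₁ = O₁`: the divisorial
coarsening with height-one centre; the general divisorial coarsening reduces to this on a bigger model, mod F-78 — separate theorem).  Flow:
✓ frame ⟹ ✓ D-abs + ✓ `mul_derivation_mem_of_isLocalization` ⟹ ✓ best `v₁`-approximation ⟹ ✓ inert (ramified contradicts `hdefect`) ⟹ GLUE 1 ⟹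
RESIDUE FRAME ⟹ `stub_cleanLU2` at `(S̄, Ō, ū)` + ✓ Abhyankar ⟹ stage `N` ⟹ `stub_persistStep` × + MONO ⟹ stage `M` with controlled coefficients ⟹
SLICE ⟹ LIFT ⟹ ✓ `lineRep_change_of_generator`. [folklore] -/
theorem cleanLU3Defect_of_heightOneCoarsening
    (hEmb : ∀ (Z : Scheme.{0}) [IsIntegral Z] [IsNoetherian Z], Scheme.IsRegular Z →
      Scheme.IsExcellent Z → ∀ (X : Set Z), IsClosed X → X ≠ Set.univ → topologicalKrullDim X ≤ 2 →
        ∃ (Z' : Scheme.{0}) (π : Z' ⟶ Z), IsProper π ∧ Function.Surjective π.base ∧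
          (∃ U : Z.Opens, (U : Set Z) = Xᶜ ∧ IsIso (π ∣_ U)) ∧
          IsStrictNormalCrossingsDivisor Z' (π.base ⁻¹' X))
    (p : ℕ) (hp : p.Prime) (k : Type) [Field k] [CharP k p] (K : Type) [Field K] [Algebra k K]
    (O : ValuationSubring K) (A : Subalgebra k K) (hAO : A.toSubring ≤ O.toSubring) (hAfg : A.FG)
    (hfrac : IsFractionRing A K)
    (hreg : IsRegularLocalRing (locAtCentre A.toSubring O))
    (hdim3 : ringKrullDim (locAtCentre A.toSubring O) = 3)
    (hzd : ∀ (T : Subring K) (hT : T ≤ O.toSubring), A.toSubring ≤ T → (subringCentre T O hT).IsMaximal)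
    (g₀ : K) (hg₀ : ∀ c : K, c ^ p ≠ g₀)
    (hdefect : ∀ f₀ : K, ∃ f₁ : K, O.valuation (g₀ - f₁ ^ p) < O.valuation (g₀ - f₀ ^ p))
    (O₁ : ValuationSubring K) (hOO₁ : O ≤ O₁) (hO₁ : O₁ ≠ ⊤)
    (hloc : locAtCentre (locAtCentre A.toSubring O) O₁ = O₁.toSubring) :
    ∃ (A' : Subalgebra k K), A'.toSubring ≤ O.toSubring ∧ A ≤ A' ∧ A'.FG ∧
    ∃ (_ : IsRegularLocalRing (locAtCentre A'.toSubring O)) (c : Fin p → K), (∃ j : Fin p, (j : ℕ) ≠ 0 ∧ c j ≠ 0) ∧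
    ((∃ (d m : ℕ) (hmd : m ≤ d) (t : Fin d → ↥(locAtCentre A'.toSubring O)) (a : Fin m → ℕ) (u : ↥(locAtCentre A'.toSubring O)), IsUnit u ∧
    Ideal.span (Set.range t) = IsLocalRing.maximalIdeal ↥(locAtCentre A'.toSubring O) ∧
    ringKrullDim ↥(locAtCentre A'.toSubring O) = (d : WithBot ℕ∞) ∧ 0 < m ∧ (∀ i, ¬ p ∣ a i) ∧
    (∑ j : Fin p, c j ^ p * g₀ ^ (j : ℕ)) = (u : K) * ∏ i : Fin m, ((t (Fin.castLE hmd i) : ↥(locAtCentre A'.toSubring O)) : K) ^ (a i)) ∨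
    (∃ u : ↥(locAtCentre A'.toSubring O), IsUnit u ∧ (∑ j : Fin p, c j ^ p * g₀ ^ (j : ℕ)) = (u : K) ∧
    ∀ c' : ↥(locAtCentre A'.toSubring O), u - c' ^ p ∉ IsLocalRing.maximalIdeal ↥(locAtCentre A'.toSubring O)) ∨
    (∃ s c' : ↥(locAtCentre A'.toSubring O), (∑ j : Fin p, c j ^ p * g₀ ^ (j : ℕ)) = (s : K) ∧
    s - c' ^ p ∈ IsLocalRing.maximalIdeal ↥(locAtCentre A'.toSubring O) ∧
    s - c' ^ p ∉ IsLocalRing.maximalIdeal ↥(locAtCentre A'.toSubring O) ^ 2)) :=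
  cleanLU3Defect_of_heightOneCoarsening_of_cleanMono hEmb p hp k
    (fun κ _ _ _ Ō Ā hĀŌ hĀfg hfr hregb hdimb hzdb ū hū => by
      haveI : Fact p.Prime := ⟨hp⟩
      haveI := hfr
      exact exists_cleanMono_stage_of_cases hEmb p (stub_cleanLU2 p hp k κ) (stub_persistCases p κ) (stub_persistE1 p κ)
        (stub_persistE2 p κ) Ō Ā hĀŌ hĀfg hregb hdimb hzdb ū hū)
    K O A hAO hAfg hfrac hreg hdim3 hzd g₀ hg₀ hdefect O₁ hOO₁ hO₁ hloc


/-- **(C-div), GENERAL DIVISORIAL CASE — THEOREM (modulo `hEmb` = F-32 and `h78 : CossartJannsenSaito2020General` = F-78).**  **General divisorial case** — as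
`cleanLU3Defect_of_heightOneCoarsening` but the coarsening `O ≤ O₁ ≠ K` is only assumed DIVISORIAL: two elements `y₀, y₁ ∈ O` whose residues in
`κ(O₁)` are algebraically independent over `k` (every nonzero `k`-polynomial in them is a unit of `O₁`).  Reduction to the height-one case on a
bigger regular model by local uniformization along the composite valuation (✓ `exists_model_regular_of_lt_of_cjs`, Cossart–Piltant 2019 Prop. 4.10,
mod F-78) and the affine dimension formula (✓ `…CompositeDivisorialHeight.lean`, ✓ `…CompositeDivisorial.lean`). [folklore] -/
theorem cleanLU3Defect_of_divisorialCoarsening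
    (hEmb : ∀ (Z : Scheme.{0}) [IsIntegral Z] [IsNoetherian Z], Scheme.IsRegular Z →
      Scheme.IsExcellent Z → ∀ (X : Set Z), IsClosed X → X ≠ Set.univ → topologicalKrullDim X ≤ 2 →
        ∃ (Z' : Scheme.{0}) (π : Z' ⟶ Z), IsProper π ∧ Function.Surjective π.base ∧
          (∃ U : Z.Opens, (U : Set Z) = Xᶜ ∧ IsIso (π ∣_ U)) ∧
          IsStrictNormalCrossingsDivisor Z' (π.base ⁻¹' X))
    (h78 : CossartJannsenSaito2020General.{0})
    (p : ℕ) (hp : p.Prime) (k : Type) [Field k] [CharP k p] (K : Type) [Field K] [Algebra k K]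
    (O : ValuationSubring K) (A : Subalgebra k K) (hAO : A.toSubring ≤ O.toSubring) (hAfg : A.FG)
    (hfrac : IsFractionRing A K)
    (hreg : IsRegularLocalRing (locAtCentre A.toSubring O))
    (hdim3 : ringKrullDim (locAtCentre A.toSubring O) = 3)
    (hzd : ∀ (T : Subring K) (hT : T ≤ O.toSubring), A.toSubring ≤ T → (subringCentre T O hT).IsMaximal)
    (g₀ : K) (hg₀ : ∀ c : K, c ^ p ≠ g₀)
    (hdefect : ∀ f₀ : K, ∃ f₁ : K, O.valuation (g₀ - f₁ ^ p) < O.valuation (g₀ - f₀ ^ p))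
    (O₁ : ValuationSubring K) (hOO₁ : O ≤ O₁) (hO₁ : O₁ ≠ ⊤)
    (y : Fin 2 → K) (hy : ∀ i, y i ∈ O)
    (hind : ∀ P : MvPolynomial (Fin 2) k, P ≠ 0 → O₁.valuation (MvPolynomial.aeval y P) = 1) :
    ∃ (A' : Subalgebra k K), A'.toSubring ≤ O.toSubring ∧ A ≤ A' ∧ A'.FG ∧
    ∃ (_ : IsRegularLocalRing (locAtCentre A'.toSubring O)) (c : Fin p → K), (∃ j : Fin p, (j : ℕ) ≠ 0 ∧ c j ≠ 0) ∧
    ((∃ (d m : ℕ) (hmd : m ≤ d) (t : Fin d → ↥(locAtCentre A'.toSubring O)) (a : Fin m → ℕ) (u : ↥(locAtCentre A'.toSubring O)), IsUnit u ∧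
    Ideal.span (Set.range t) = IsLocalRing.maximalIdeal ↥(locAtCentre A'.toSubring O) ∧
    ringKrullDim ↥(locAtCentre A'.toSubring O) = (d : WithBot ℕ∞) ∧ 0 < m ∧ (∀ i, ¬ p ∣ a i) ∧
    (∑ j : Fin p, c j ^ p * g₀ ^ (j : ℕ)) = (u : K) * ∏ i : Fin m, ((t (Fin.castLE hmd i) : ↥(locAtCentre A'.toSubring O)) : K) ^ (a i)) ∨
    (∃ u : ↥(locAtCentre A'.toSubring O), IsUnit u ∧ (∑ j : Fin p, c j ^ p * g₀ ^ (j : ℕ)) = (u : K) ∧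
    ∀ c' : ↥(locAtCentre A'.toSubring O), u - c' ^ p ∉ IsLocalRing.maximalIdeal ↥(locAtCentre A'.toSubring O)) ∨
    (∃ s c' : ↥(locAtCentre A'.toSubring O), (∑ j : Fin p, c j ^ p * g₀ ^ (j : ℕ)) = (s : K) ∧
    s - c' ^ p ∈ IsLocalRing.maximalIdeal ↥(locAtCentre A'.toSubring O) ∧
    s - c' ^ p ∉ IsLocalRing.maximalIdeal ↥(locAtCentre A'.toSubring O) ^ 2)) :=
  cleanLU3Defect_of_divisorialCoarsening_of_cleanMono hEmb h78 p hp k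
    (fun κ _ _ _ Ō Ā hĀŌ hĀfg hfr hregb hdimb hzdb ū hū => by
      haveI : Fact p.Prime := ⟨hp⟩
      haveI := hfr
      exact exists_cleanMono_stage_of_cases hEmb p (stub_cleanLU2 p hp k κ) (stub_persistCases p κ) (stub_persistE1 p κ)
        (stub_persistE2 p κ) Ō Ā hĀŌ hĀfg hregb hdimb hzdb ū hū)
    K O A hAO hAfg hfrac hreg hdim3 hzd g₀ hg₀ hdefect O₁ hOO₁ hO₁ y hy hind

end Summit.ResolutionOfSingularities.ResolutionOfSingularities.Theorems.RadicialJung.CleanModels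

end
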